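import Literature.Computability.MetaComplexity.BoundedArithTheories
import Literature.Computability.MetaComplexity.BoundedArithSyntaxProofs
import HarnessLib

/-!
# `S₂ⁱ`, `T₂ⁱ`: discharge of the cumulativity named facts

Sibling proof file of `BoundedArithTheories.lean` (D-0014: named facts `def X : Prop` are
discharged as `theorem X_holds : X`).  Using the cumulativity of the `Σᵇ` hierarchy
(`IsSigmab.mono_holds`, `BoundedArithSyntaxProofs.lean`) it discharges

* `Literature.Computability.MetaComplexity.sigmabFormulas_mono_holds` — the families `Σᵇᵢ` of induction formulas are
  cumulative in `i`;
* `Literature.Computability.MetaComplexity.S2_mono_holds` — `S₂ⁱ ⊆ S₂ʲ` for `i ≤ j` (axiom-wise);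
* `Literature.Computability.MetaComplexity.T2_mono_holds` — `T₂ⁱ ⊆ T₂ʲ` for `i ≤ j` (axiom-wise);
* `Literature.Computability.MetaComplexity.IsSigmabDefinable.mono_level_holds` — `Σᵇᵢ`-definability of a function is
  monotone in `i`;

exactly by the interim proofs preserved as comments in `BoundedArithTheories.lean`
(Buss 1986, §2.1, §2.4: `Σᵇᵢ ⊆ Σᵇᵢ₊₁`, hence `S₂ⁱ ⊆ S₂ⁱ⁺¹`, `T₂ⁱ ⊆ T₂ⁱ⁺¹`).  Consequences for
models: a model of `T₂ʲ` (`S₂ʲ`) is a model of `T₂ⁱ` (`S₂ⁱ`) for `i ≤ j`.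

## References

* S. R. Buss, *Bounded Arithmetic*, Bibliopolis 1986, §2.1, §2.4.
* J. Krajíček, *Bounded Arithmetic, Propositional Logic and Complexity Theory*, CUP 1995,
  Def. 5.2.3.
-/

namespace Literature.Computability.MetaComplexity

open FirstOrder FirstOrder.Language

/-- Discharge of `sigmabFormulas_mono`: the families `Σᵇᵢ` are cumulative in `i`
(Buss 1986, §2.1). [cite: Buss1986, §2.1] -/
theorem sigmabFormulas_mono_holds : sigmabFormulas_mono :=
  fun hij _ _ hφ => IsSigmab.mono_holds hij hφ

/-- Discharge of `S2_mono`: `S₂ⁱ ⊆ S₂ʲ` for `i ≤ j` (Buss 1986, §2.4). [cite: Buss1986, §2.4] -/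
theorem S2_mono_holds : S2_mono :=
  fun h => Set.union_subset_union_right _ (PINDScheme_mono (sigmabFormulas_mono_holds h))

/-- Discharge of `T2_mono`: `T₂ⁱ ⊆ T₂ʲ` for `i ≤ j` (Buss 1986, §2.4). [cite: Buss1986, §2.4] -/
theorem T2_mono_holds : T2_mono :=
  fun h => Set.union_subset_union_right _ (INDScheme_mono (sigmabFormulas_mono_holds h))

/-- Discharge of `IsSigmabDefinable.mono_level`: `Σᵇᵢ`-definability is monotone in the level
(Buss 1986, Ch. 5). [cite: Buss1986, Ch. 5] -/
theorem IsSigmabDefinable.mono_level_holds {T : Language.boundedArith.Theory} {i j : ℕ}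
    {f : ℕ → ℕ} : IsSigmabDefinable.mono_level (T := T) (i := i) (j := j) (f := f) := by
  intro hij hf
  obtain ⟨φ, hφ, hreal, htot, huniq⟩ := hf
  exact ⟨φ, IsSigmab.mono_holds hij hφ, hreal, htot, huniq⟩

/-- A model of `T₂ʲ` is a model of `T₂ⁱ` for `i ≤ j` (Buss 1986, §2.4). [cite: Buss1986, §2.4] -/
theorem model_T2_of_le {M : Type*} [Language.boundedArith.Structure M] {i j : ℕ} (hij : i ≤ j)
    (h : M ⊨ T2 j) : M ⊨ T2 i :=
  h.mono (T2_mono_holds hij)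

/-- A model of `S₂ʲ` is a model of `S₂ⁱ` for `i ≤ j` (Buss 1986, §2.4). [cite: Buss1986, §2.4] -/
theorem model_S2_of_le {M : Type*} [Language.boundedArith.Structure M] {i j : ℕ} (hij : i ≤ j)
    (h : M ⊨ S2 j) : M ⊨ S2 i :=
  h.mono (S2_mono_holds hij)

/-- A model of `T₂ⁱ` satisfies the scheme `Σᵇⱼ-IND` for every `j ≤ i` (Buss 1986, §2.4).
[cite: Buss1986, §2.4] -/
theorem model_INDScheme_of_model_T2 {M : Type*} [Language.boundedArith.Structure M] {i j : ℕ}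
    (hji : j ≤ i) (h : M ⊨ T2 i) : M ⊨ INDScheme (sigmabFormulas j) :=
  (model_T2_of_le hji h).mono Set.subset_union_right

/-- A model of `S₂ⁱ` satisfies the scheme `Σᵇⱼ-PIND` for every `j ≤ i` (Buss 1986, §2.4).
[cite: Buss1986, §2.4] -/
theorem model_PINDScheme_of_model_S2 {M : Type*} [Language.boundedArith.Structure M] {i j : ℕ}
    (hji : j ≤ i) (h : M ⊨ S2 i) : M ⊨ PINDScheme (sigmabFormulas j) :=
  (model_S2_of_le hji h).mono Set.subset_union_right

end Literature.Computability.MetaComplexity
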